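import Literature.Geometry.Kaehler.ComplexTorusIntegralHodgeLatticeTopMinimalClassMaximalIndex
import HarnessLib

/-!
# The `θ`-degrees of the integral Hodge classes in EVERY codimension: `{⟨θ^{∧(g−k)}, z⟩_e : z ∈ Hdgᵏ(X, ℤ)} = δ_k·ℤ` with
# `(g−k)!·d₁⋯d_{g−k} ∣ δ_k`, `δ_k·(k!·d₁⋯d_k) ∣ g!·d₁⋯d_g`, `δ_{k+1} ∣ δ_k`, `δ_g = 1`, `δ_0 = g!·d₁⋯d_g`, and `δ_p = ((g−p)!·d₁⋯d_{g−p})·n_p` for `2p ≤ g`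

Layer `Literature/Geometry/Kaehler`, namespace `Literature.Geometry.Kaehler.ComplexTorus`; lane `lit-hodgefound`
(Track 2 foundations library), seat p09, generation 49, row g49-#11. THEOREMS ONLY (0 definitions); no named fact, net debt 0.
The `θ`-degree index `n_p` of g48-#6/g49-#7 was defined through the integral Lefschetz form `⟨·, γ_{g−2p} ∧ ·⟩_e`, hence only for `2p ≤ g`. This file treats the
`θ`-degrees `deg_θ(z) = ⟨θ^{∧l}, z⟩_e` (`k + l = g`) of the integral Hodge classes `z ∈ Hdgᵏ(X, ℤ)` of ANY codimension `k ≤ g` directly: they form a subgroup of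
`ℤ` (integrality of the cup product, Lange §6.2.4), non-zero on the minimal class `γ_k = θ^{∧k}/(k!·d₁⋯d_k)` (`⟨θ^{∧l}, θ^{∧k}⟩_e = ±g!·d₁⋯d_g`, Cor. 2.5.17 (d)), hence
`= δ·ℤ` for a unique `δ > 0`, the LEAST POSITIVE `θ`-DEGREE OF A CODIMENSION-`k` INTEGRAL HODGE CLASS (for `k = g − 1`: of an integral Hodge curve class). A generator
`δ` is characterised by «`δ` divides every degree and is a degree» (no definition is introduced):

* §1 `sign(e)·⟨θ^{∧a}, θ^{∧b}⟩_e = (−1)^g·g!·d₁⋯d_g` for `a + b = g` (`IsPolarizationType.orientationSign_mul_poincarePairing_wedgePow_wedgePow`) and the Lefschetz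
  operator preserves `θ`-degrees: `⟨θ^{∧a}, θ ∧ y⟩_e = ⟨θ^{∧(a+1)}, y⟩_e` (`poincarePairing_wedgePow_lefschetzPow_one`).
* §2 EXISTENCE AND BOUNDS: a generator `δ` exists (`IsPolarizationType.exists_thetaDegree_generator`), is unique (`….thetaDegree_generator_unique`), and satisfies
  **`0 < δ`, `(l!·d₁⋯d_l) ∣ δ`, `δ·(k!·d₁⋯d_k) ∣ g!·d₁⋯d_g`** (`….thetaDegree_generator_pos_dvd`: every degree is `(l!·d₁⋯d_l)·⟨γ_l, z⟩`; `γ_k ∈ Hdgᵏ(X, ℤ)` has degree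
  `±g!·d₁⋯d_g/(k!·d₁⋯d_k)`); so **`δ_g = 1`** and **`δ_0 = g!·d₁⋯d_g`** (`….thetaDegree_generator_top`, `….thetaDegree_generator_zero`); principal: `l! ∣ δ_k ∣ g!/k!`, e.g.
  the least `θ`-degree of an integral Hodge curve class divides `g`.
* §3 THE CHAIN **`δ_{k+1} ∣ δ_k`** (`IsPolarizationType.thetaDegree_generator_succ_dvd`): `θ ∧ Hdgᵏ(X, ℤ) ⊆ Hdgᵏ⁺¹(X, ℤ)` with the same degrees.
* §4 THE LOWER HALF: for `2p + q = g` and the Lefschetz form `B = ⟨·, γ_q ∧ ·⟩_e`, **`δ_p = ((g−p)!·d₁⋯d_{g−p})·n_p`** with `n_p = [B(γ_p, H^{2p}(X, ℤ)) : B(γ_p, Hdgᵖ(X, ℤ))]`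
  (`IsPolarizationType.thetaDegree_generator_eq_content_mul_relIndex`, from g49-#7's `poincarePairing_wedgePow_hodgeLattice_eq_content_mul`).

* §5 (appended, g49-#12) THE GENERAL POLARISED ABELIAN VARIETY IN EVERY CODIMENSION: **`dim_ℚ Bᵏ(X) = 1` (e.g. `Sp ⊆ Hg(X)`) `⟹ δ_k·(k!·d₁⋯d_k) = g!·d₁⋯d_g`**
  (`IsPolarizationType.thetaDegree_generator_mul_content_eq_of_finrank_hodgeClasses_eq_one`, `…_of_spGroup_le`): all `θ`-degrees of codimension-`k` integral Hodge classes
  are multiples of the degree of the minimal class — also in the upper half `k > g/2`; principal `k = g − 1`: every integral Hodge curve class on a very general p.p.a.v.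
  has `θ`-degree divisible by `g`.
## References

* [cite: Lange2023AbelianVarietiesComplex, §2.5.3 Thm. 2.5.16, Cor. 2.5.17 (d) (PDF p. 135); §6.2.4 (PDF p. 310 L9–L13); §1.7.2 Lemma 1.7.5; §4.2 Poincaré's formula (PDF p. 204); §5.4.1 (5.22)–(5.23) (PDF p. 275); §7.3.2 (1)]
* [cite: BenoistDebarre2023SmoothSubvarietiesJacobians, §1 (p. 3); §3 Prop. 3.3 and proof of Thm. 3.7 (p. 7)]
* [cite: VoisinHodgeI2002, §6.2.3 Lemma 6.26; §7.1.2 (PDF p. 134)]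
-/

noncomputable section

-- `Module ℂ` / `SMulZeroClass ℂ` synthesis on `E [⋀^Fin k]→L[ℝ] ℂ` (as in `ComplexTorusLefschetzDecomposition`)
set_option maxSynthPendingDepth 3

open Module Function Complex
open LinearMap (BilinForm)
open Literature.LinearAlgebra.Alternating
open Literature.Analysis.Complex (IsOfTypeAt typeSubmodule mem_typeSubmodule_iff_isOfTypeAt)

namespace Literature.Geometry.Kaehler.ComplexTorus

/-! ## §0 Subgroups of `ℤ` -/

section Generic

/-- Every subgroup of `ℤ` is `mℤ` with `m` its index. [folklore] -/
private theorem eq_zmultiples_index₁₀₂ (S : AddSubgroup ℤ) : S = AddSubgroup.zmultiples (S.index : ℤ) := by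
  obtain ⟨a, ha⟩ := Int.subgroup_cyclic S
  rw [← AddSubgroup.zmultiples_eq_closure] at ha
  rw [ha, Int.index_zmultiples, Int.zmultiples_natAbs]

/-- Two positive naturals dividing each other (in `ℤ`) are equal. [folklore] -/
private theorem eq_of_dvd_dvd₁₀₂ {a b : ℕ} (h₁ : (a : ℤ) ∣ b) (h₂ : (b : ℤ) ∣ a) : a = b :=
  Nat.dvd_antisymm (Int.natCast_dvd_natCast.1 h₁) (Int.natCast_dvd_natCast.1 h₂)

end Generic

/-! ## §1 `⟨θ^{∧a}, θ^{∧b}⟩_e = ±g!·d₁⋯d_g` and `⟨θ^{∧a}, θ ∧ y⟩_e = ⟨θ^{∧(a+1)}, y⟩_e` -/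

section Pairing

variable {ι : Type*} [Fintype ι] [DecidableEq ι] {E : Type*} [NormedAddCommGroup E] [NormedSpace ℂ E]
  (Φ : (ι → ℝ) ≃L[ℝ] E) {n : ℕ} {η : E [⋀^Fin 2]→L[ℝ] ℝ}

omit [Fintype ι] in
/-- The orientation sign of a re-typed enumeration. [folklore] -/
private theorem orientationSign_finCongr_trans₁₀₂ {m : ℕ} (h : m = n) (e : Fin n ≃ ι) :
    orientationSign Φ ((finCongr h).trans e) = orientationSign Φ e := by
  subst h
  rfl

/-- **`sign(e)·⟨θ^{∧a}, θ^{∧b}⟩_e = ∫_X θ^{∧g} = (−1)^g·g!·d₁⋯d_g`** for a polarisation of type `(d₁, …, d_g)` and `a + b = g` (Riemann–Roch ∕ the degree of `θ`,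
Cor. 2.5.17 (d), with Lange's sign `(−1)^g` of `∫_X` on the symplectic frame and the orientation sign of `e`).
[cite: Lange2023AbelianVarietiesComplex, §1.7.2 Lemma 1.7.5; §2.5.3 Cor. 2.5.17 (d) (PDF p. 135); §6.2.4 (PDF p. 310)] -/
theorem IsPolarizationType.orientationSign_mul_poincarePairing_wedgePow_wedgePow {g : ℕ} {d : Fin g → ℕ} (hd : IsPolarizationType Φ η d)
    (hη : IsRiemannForm Φ η) {a b : ℕ} (hg : a + b = g) (e : Fin n ≃ ι) (hn : 2 * a + 2 * b = n) :
    (orientationSign Φ e : ℂ) * poincarePairing Φ e hn (wedgePow (ofRealForm η) a) (wedgePow (ofRealForm η) b) =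
      (-1) ^ g * (g.factorial : ℂ) * ∏ i, (d i : ℂ) := by
  subst hg
  rw [poincarePairing_eq_orientationSign_mul_torusIntegral_wedge Φ e hn, orientationSign_finCongr_trans₁₀₂ Φ hn e, ← mul_assoc,
    ← Int.cast_mul, orientationSign_mul_self, Int.cast_one, one_mul, wedgePow_wedge_wedgePow (ofRealForm η) a b, ← torusIntegral_finCongr_trans Φ]
  exact hη.torusIntegral_wedgePow_of_isPolarizationType Φ hd _

omit [Fintype ι] in
/-- Re-typing the right argument of the pairing along `l = l'`. [folklore] -/
private theorem poincarePairing_domDomCongr_right₁₀₂ (e : Fin n ≃ ι) {k l l' : ℕ} (hl : l = l') (h : k + l = n) (h' : k + l' = n)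
    (γ : E [⋀^Fin k]→L[ℝ] ℂ) (δ : E [⋀^Fin l]→L[ℝ] ℂ) :
    poincarePairing Φ e h' γ (δ.domDomCongr (finCongr hl)) = poincarePairing Φ e h γ δ := by
  subst hl; rfl

omit [Fintype ι] in
/-- **The Lefschetz operator preserves `θ`-degrees: `⟨θ^{∧a}, θ ∧ y⟩_e = ⟨θ^{∧(a+1)}, y⟩_e`** (`θ^{∧a} ∧ (θ ∧ y) = θ^{∧(a+1)} ∧ y`; the bundled `L¹ = lefschetzPow η 1`).
[cite: Lange2023AbelianVarietiesComplex, §6.2.4 (PDF p. 310); §7.3.2 (1)] [cite: VoisinHodgeI2002, §6.2.3 Lemma 6.26] -/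
theorem poincarePairing_wedgePow_lefschetzPow_one (η : E [⋀^Fin 2]→L[ℝ] ℝ) (e : Fin n ≃ ι) {a m m' : ℕ} (h1 : 2 * 1 + m = m') (hn : 2 * a + m' = n)
    (hn' : 2 * (a + 1) + m = n) (y : E [⋀^Fin m]→L[ℝ] ℂ) :
    poincarePairing Φ e hn (wedgePow (ofRealForm η) a) (lefschetzPow η 1 h1 y) = poincarePairing Φ e hn' (wedgePow (ofRealForm η) (a + 1)) y := by
  have hA : 2 * a + (2 * 1 + m) = n := by omega
  rw [lefschetzPow_apply, poincarePairing_domDomCongr_right₁₀₂ Φ e h1 hA hn, poincarePairing_wedgePow_wedgePow_wedge Φ (ofRealForm η) e hA hn']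

end Pairing

/-! ## §2 The `θ`-degree group of `Hdgᵏ(X, ℤ)` and its generator `δ_k` -/

section Degrees

variable {ι : Type*} [Fintype ι] [DecidableEq ι] {E : Type*} [NormedAddCommGroup E] [NormedSpace ℂ E]
  {Φ : (ι → ℝ) ≃L[ℝ] E} {j n k l : ℕ} {η : E [⋀^Fin 2]→L[ℝ] ℝ} {d : Fin (j + 2) → ℕ}

/-- **THE `θ`-DEGREES OF THE CODIMENSION-`k` INTEGRAL HODGE CLASSES FORM A GROUP `δ·ℤ` WITH `δ > 0` A DEGREE** (`k + l = g`, `deg_θ(z) = ⟨θ^{∧l}, z⟩_e ∈ ℤ`): there is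
`δ > 0` dividing every `deg_θ(z)`, `z ∈ Hdgᵏ(X, ℤ)`, and attained by some `z` — the degrees form a subgroup of `ℤ` (integrality of the cup product), non-zero on the
minimal class `γ_k`. [cite: Lange2023AbelianVarietiesComplex, §6.2.4 (PDF p. 310 L9–L13); §2.5.3 Thm. 2.5.16, Cor. 2.5.17 (d) (PDF p. 135)] [cite: BenoistDebarre2023SmoothSubvarietiesJacobians, §1 (p. 3)] -/
theorem IsPolarizationType.exists_thetaDegree_generator (hd : IsPolarizationType Φ η d) (hη : IsRiemannForm Φ η) (hk : k ≤ j + 2) (hkl : k + l = j + 2)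
    (e : Fin n ≃ ι) (hn : 2 * l + 2 * k = n) :
    ∃ δ : ℕ, 0 < δ ∧
      (∀ z ∈ integralHodgeClassesIn Φ (2 * k) k, ∃ c : ℤ, poincarePairing Φ e hn (wedgePow (ofRealForm η) l) z = c ∧ (δ : ℤ) ∣ c) ∧
      ∃ z ∈ integralHodgeClassesIn Φ (2 * k) k, poincarePairing Φ e hn (wedgePow (ofRealForm η) l) z = (δ : ℂ) := by
  have hl : l ≤ j + 2 := by omega
  have hθZ : wedgePow (ofRealForm η) l ∈ integralForms Φ (2 * l) := wedgePow_mem_integralForms Φ (ofRealForm_mem_integralForms_two Φ hη.isNSForm) l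
  -- the subgroup of degrees
  let S : AddSubgroup ℤ :=
    { carrier := {c : ℤ | ∃ z ∈ integralHodgeClassesIn Φ (2 * k) k, poincarePairing Φ e hn (wedgePow (ofRealForm η) l) z = c}
      add_mem' := by
        rintro a b ⟨z, hz, hza⟩ ⟨w, hw, hwb⟩
        exact ⟨z + w, add_mem hz hw, by rw [map_add, hza, hwb, Int.cast_add]⟩
      zero_mem' := ⟨0, zero_mem _, by rw [map_zero, Int.cast_zero]⟩
      neg_mem' := by
        rintro a ⟨z, hz, hza⟩
        exact ⟨-z, neg_mem hz, by rw [map_neg, hza, Int.cast_neg]⟩ }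
  have hS := eq_zmultiples_index₁₀₂ S
  -- every degree is an integer of `S`
  have hdeg : ∀ z ∈ integralHodgeClassesIn Φ (2 * k) k, ∃ c : ℤ, poincarePairing Φ e hn (wedgePow (ofRealForm η) l) z = c ∧ c ∈ S := fun z hz ↦ by
    obtain ⟨c, hc⟩ := poincarePairing_mem_range_int Φ e hn hθZ (integralHodgeClassesIn_le_integralForms Φ (2 * k) k hz)
    exact ⟨c, hc, z, hz, hc⟩
  -- the minimal class `γ_k` has non-zero degree, so the index `δ = [ℤ : S]` is positive
  obtain ⟨γ, hγZ, hγ⟩ := hd.exists_mem_integralForms_wedgePow_eq_content_smul hk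
  have hγH := mem_integralHodgeClassesIn_of_wedgePow_eq_content_smul hd hη hk hγZ hγ
  obtain ⟨c₀, hc₀, hc₀S⟩ := hdeg γ hγH
  have hval := hd.orientationSign_mul_poincarePairing_wedgePow_wedgePow Φ hη (show l + k = j + 2 by omega) e hn
  rw [hγ, map_smul, smul_eq_mul, hc₀] at hval
  have hc₀0 : c₀ ≠ 0 := by
    rintro rfl
    rw [Int.cast_zero, mul_zero, mul_zero] at hval
    have hpos : (0 : ℂ) ≠ (-1) ^ (j + 2) * ((j + 2).factorial : ℂ) * ∏ i, (d i : ℂ) := by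
      have h : ((-1 : ℂ)) ^ (j + 2) * ((j + 2).factorial : ℂ) * ∏ i, (d i : ℂ) ≠ 0 :=
        mul_ne_zero (mul_ne_zero (pow_ne_zero _ (neg_ne_zero.2 one_ne_zero)) (by exact_mod_cast (Nat.factorial_pos _).ne'))
          (Finset.prod_ne_zero_iff.2 fun i _ ↦ by exact_mod_cast (hd.pos hη i).ne')
      exact fun h0 ↦ h h0.symm
    exact hpos hval
  have hδ0 : S.index ≠ 0 := by
    intro h0
    rw [h0, Nat.cast_zero, AddSubgroup.zmultiples_zero_eq_bot] at hS
    rw [hS] at hc₀S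
    exact hc₀0 (AddSubgroup.mem_bot.1 hc₀S)
  refine ⟨S.index, Nat.pos_of_ne_zero hδ0, fun z hz ↦ ?_, ?_⟩
  · obtain ⟨c, hc, hcS⟩ := hdeg z hz
    rw [hS, Int.mem_zmultiples_iff] at hcS
    exact ⟨c, hc, hcS⟩
  · have hmem : ((S.index : ℕ) : ℤ) ∈ AddSubgroup.zmultiples ((S.index : ℕ) : ℤ) := AddSubgroup.mem_zmultiples _
    rw [← hS] at hmem
    obtain ⟨z, hz, hzδ⟩ := hmem
    exact ⟨z, hz, by rw [hzδ, Int.cast_natCast]⟩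

omit [Fintype ι] in
/-- **Uniqueness of the generator**: if `δ` and `δ'` both divide all `θ`-degrees of `Hdgᵏ(X, ℤ)` and are attained, then `δ = δ'`. [folklore]
[cite: Lange2023AbelianVarietiesComplex, §6.2.4 (PDF p. 310)] -/
theorem thetaDegree_generator_unique (e : Fin n ≃ ι) (hn : 2 * l + 2 * k = n) {δ δ' : ℕ}
    (hδ : (∀ z ∈ integralHodgeClassesIn Φ (2 * k) k, ∃ c : ℤ, poincarePairing Φ e hn (wedgePow (ofRealForm η) l) z = c ∧ (δ : ℤ) ∣ c) ∧
      ∃ z ∈ integralHodgeClassesIn Φ (2 * k) k, poincarePairing Φ e hn (wedgePow (ofRealForm η) l) z = (δ : ℂ))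
    (hδ' : (∀ z ∈ integralHodgeClassesIn Φ (2 * k) k, ∃ c : ℤ, poincarePairing Φ e hn (wedgePow (ofRealForm η) l) z = c ∧ (δ' : ℤ) ∣ c) ∧
      ∃ z ∈ integralHodgeClassesIn Φ (2 * k) k, poincarePairing Φ e hn (wedgePow (ofRealForm η) l) z = (δ' : ℂ)) : δ = δ' := by
  obtain ⟨z, hz, hzδ⟩ := hδ.2
  obtain ⟨z', hz', hz'δ⟩ := hδ'.2
  obtain ⟨c, hc, hdc⟩ := hδ'.1 z hz
  obtain ⟨c', hc', hdc'⟩ := hδ.1 z' hz'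
  have h1 : c = δ := by exact_mod_cast hc.symm.trans hzδ
  have h2 : c' = δ' := by exact_mod_cast hc'.symm.trans hz'δ
  rw [h1] at hdc
  rw [h2] at hdc'
  exact eq_of_dvd_dvd₁₀₂ hdc' hdc

/-- **THE BOUNDS: `0 < δ_k`, `(l!·d₁⋯d_l) ∣ δ_k` and `δ_k·(k!·d₁⋯d_k) ∣ g!·d₁⋯d_g`** (`k + l = g`): every degree `⟨θ^{∧l}, z⟩ = (l!·d₁⋯d_l)·⟨γ_l, z⟩` is a multiple of the
content of `θ^{∧l}` (`γ_l` integral), and the minimal class `γ_k ∈ Hdgᵏ(X, ℤ)` has degree `⟨θ^{∧l}, θ^{∧k}⟩/(k!·d₁⋯d_k) = ±g!·d₁⋯d_g/(k!·d₁⋯d_k)`. For a principal polarisation: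
`l! ∣ δ_k ∣ g!/k!`. [cite: Lange2023AbelianVarietiesComplex, §2.5.3 Thm. 2.5.16, Cor. 2.5.17 (d) (PDF p. 135); §6.2.4 (PDF p. 310 L9–L13)] [cite: BenoistDebarre2023SmoothSubvarietiesJacobians, §1 (p. 3); §3 Prop. 3.3] -/
theorem IsPolarizationType.thetaDegree_generator_pos_dvd (hd : IsPolarizationType Φ η d) (hη : IsRiemannForm Φ η) (hk : k ≤ j + 2) (hl : l ≤ j + 2)
    (hkl : k + l = j + 2) (e : Fin n ≃ ι) (hn : 2 * l + 2 * k = n) {δ : ℕ}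
    (hδ : (∀ z ∈ integralHodgeClassesIn Φ (2 * k) k, ∃ c : ℤ, poincarePairing Φ e hn (wedgePow (ofRealForm η) l) z = c ∧ (δ : ℤ) ∣ c) ∧
      ∃ z ∈ integralHodgeClassesIn Φ (2 * k) k, poincarePairing Φ e hn (wedgePow (ofRealForm η) l) z = (δ : ℂ)) :
    0 < δ ∧ (l.factorial * ∏ i : Fin l, d (Fin.castLE hl i)) ∣ δ ∧ δ * (k.factorial * ∏ i : Fin k, d (Fin.castLE hk i)) ∣ (j + 2).factorial * ∏ i, d i := by
  -- the minimal class `γ_k` and its degree `c₀` with `(k!·d₁⋯d_k)·c₀ = ±g!·d₁⋯d_g`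
  obtain ⟨γ, hγZ, hγ⟩ := hd.exists_mem_integralForms_wedgePow_eq_content_smul hk
  have hγH := mem_integralHodgeClassesIn_of_wedgePow_eq_content_smul hd hη hk hγZ hγ
  obtain ⟨c₀, hc₀, hδc₀⟩ := hδ.1 γ hγH
  have hval := hd.orientationSign_mul_poincarePairing_wedgePow_wedgePow Φ hη (show l + k = j + 2 by omega) e hn
  rw [hγ, map_smul, smul_eq_mul, hc₀] at hval
  -- in `ℤ`: `sign(e)·C_k·c₀ = (−1)^g·C_g`
  have hvalZ : orientationSign Φ e * (((k.factorial * ∏ i : Fin k, d (Fin.castLE hk i)) : ℕ) : ℤ) * c₀ =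
      (-1) ^ (j + 2) * ((((j + 2).factorial * ∏ i, d i) : ℕ) : ℤ) := by
    apply Int.cast_injective (α := ℂ)
    push_cast at hval ⊢
    linear_combination hval
  have habs : (k.factorial * ∏ i : Fin k, d (Fin.castLE hk i)) * c₀.natAbs = (j + 2).factorial * ∏ i, d i := by
    have h := congrArg Int.natAbs hvalZ
    have hs : (orientationSign Φ e).natAbs = 1 := by
      have h1 := congrArg Int.natAbs (orientationSign_mul_self Φ e)
      rw [Int.natAbs_mul, Int.natAbs_one] at h1
      exact Nat.eq_one_of_mul_eq_one_left h1
    simp only [Int.natAbs_mul, Int.natAbs_pow, Int.natAbs_neg, Int.natAbs_one, one_pow, one_mul, Int.natAbs_natCast, hs] at h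
    exact h
  -- the generator `δ` is a degree: `δ = (l!·d₁⋯d_l)·c'`
  obtain ⟨z, hz, hzδ⟩ := hδ.2
  obtain ⟨c', hc'⟩ := (hd.exists_poincarePairing_wedgePow_eq_content hη hl e hn).1 z (integralHodgeClassesIn_le_integralForms Φ (2 * k) k hz)
  have hδc' : (δ : ℤ) = ((l.factorial * ∏ i : Fin l, d (Fin.castLE hl i) : ℕ) : ℤ) * c' := by exact_mod_cast hzδ.symm.trans hc'
  have hδpos : 0 < δ := by
    refine Nat.pos_of_ne_zero fun h0 ↦ ?_
    rw [h0, Nat.cast_zero] at hδc₀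
    have hc0 : c₀ = 0 := by simpa using hδc₀
    rw [hc0, Int.natAbs_zero, mul_zero] at habs
    exact (Nat.mul_pos (Nat.factorial_pos _) (Finset.prod_pos fun i _ ↦ hd.pos hη i)).ne' habs.symm
  refine ⟨hδpos, Int.natCast_dvd_natCast.1 ⟨c', hδc'⟩, ?_⟩
  -- `δ ∣ c₀`, so `δ·C_k ∣ |c₀|·C_k = C_g`
  have h1 : δ ∣ c₀.natAbs := Int.natCast_dvd.1 hδc₀
  rw [← habs, mul_comm δ]
  exact mul_dvd_mul_left _ h1

/-- **`δ_g = 1`**: `Hdgᵍ(X, ℤ) = H^{2g}(X, ℤ)` contains a class of `θ^{∧0}`-degree `1` (a generator of `H^{2g}(X, ℤ) ≅ ℤ`; from §2's bound `δ_g·(g!·d₁⋯d_g) ∣ g!·d₁⋯d_g`).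
[cite: Lange2023AbelianVarietiesComplex, §2.5.3 Cor. 2.5.17 (d) (PDF p. 135); §6.2.4 (PDF p. 310)] -/
theorem IsPolarizationType.thetaDegree_generator_top (hd : IsPolarizationType Φ η d) (hη : IsRiemannForm Φ η) (e : Fin n ≃ ι) (hn : 2 * 0 + 2 * (j + 2) = n) {δ : ℕ}
    (hδ : (∀ z ∈ integralHodgeClassesIn Φ (2 * (j + 2)) (j + 2), ∃ c : ℤ, poincarePairing Φ e hn (wedgePow (ofRealForm η) 0) z = c ∧ (δ : ℤ) ∣ c) ∧
      ∃ z ∈ integralHodgeClassesIn Φ (2 * (j + 2)) (j + 2), poincarePairing Φ e hn (wedgePow (ofRealForm η) 0) z = (δ : ℂ)) : δ = 1 := by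
  have h := (hd.thetaDegree_generator_pos_dvd hη le_rfl (Nat.zero_le _) rfl e hn hδ).2.2
  have hpos : 0 < (j + 2).factorial * ∏ i, d i := Nat.mul_pos (Nat.factorial_pos _) (Finset.prod_pos fun i _ ↦ hd.pos hη i)
  have hC : (j + 2).factorial * ∏ i : Fin (j + 2), d (Fin.castLE le_rfl i) = (j + 2).factorial * ∏ i, d i := rfl
  rw [hC] at h
  have h3 : δ * ((j + 2).factorial * ∏ i, d i) = (j + 2).factorial * ∏ i, d i := Nat.dvd_antisymm h (Nat.dvd_mul_left _ _)
  exact Nat.eq_of_mul_eq_mul_right hpos (h3.trans (one_mul _).symm)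

/-- **`δ_0 = g!·d₁⋯d_g`**: `Hdg⁰(X, ℤ) = ℤ·1` and `deg_θ(1) = ⟨θ^{∧g}, 1⟩_e = ±g!·d₁⋯d_g` (from §2's bounds `(g!·d₁⋯d_g) ∣ δ_0` and `δ_0·1 ∣ g!·d₁⋯d_g`).
[cite: Lange2023AbelianVarietiesComplex, §2.5.3 Cor. 2.5.17 (d) (PDF p. 135); §6.2.4 (PDF p. 310)] -/
theorem IsPolarizationType.thetaDegree_generator_zero (hd : IsPolarizationType Φ η d) (hη : IsRiemannForm Φ η) (e : Fin n ≃ ι) (hn : 2 * (j + 2) + 2 * 0 = n) {δ : ℕ}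
    (hδ : (∀ z ∈ integralHodgeClassesIn Φ (2 * 0) 0, ∃ c : ℤ, poincarePairing Φ e hn (wedgePow (ofRealForm η) (j + 2)) z = c ∧ (δ : ℤ) ∣ c) ∧
      ∃ z ∈ integralHodgeClassesIn Φ (2 * 0) 0, poincarePairing Φ e hn (wedgePow (ofRealForm η) (j + 2)) z = (δ : ℂ)) :
    δ = (j + 2).factorial * ∏ i, d i := by
  have h := hd.thetaDegree_generator_pos_dvd hη (Nat.zero_le _) le_rfl (Nat.zero_add _) e hn hδ
  have hC : (j + 2).factorial * ∏ i : Fin (j + 2), d (Fin.castLE le_rfl i) = (j + 2).factorial * ∏ i, d i := rfl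
  have h2 := h.2.1
  have h3 := h.2.2
  rw [hC] at h2
  simp only [Nat.factorial_zero, Finset.univ_eq_empty, Finset.prod_empty, mul_one] at h3
  exact Nat.dvd_antisymm h3 h2

end Degrees

/-! ## §3 The chain `δ_{k+1} ∣ δ_k` -/

section Chain

variable {ι : Type*} [Fintype ι] [DecidableEq ι] {E : Type*} [NormedAddCommGroup E] [NormedSpace ℂ E]
  {Φ : (ι → ℝ) ≃L[ℝ] E} {j n k l : ℕ} {η : E [⋀^Fin 2]→L[ℝ] ℝ} {d : Fin (j + 2) → ℕ}

omit [Fintype ι] in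
/-- **THE `θ`-DEGREE GROUPS INCREASE WITH THE CODIMENSION: `δ_{k+1} ∣ δ_k`** (`k + (l + 1) = g`): the Lefschetz operator `z ↦ θ ∧ z` maps `Hdgᵏ(X, ℤ)` into
`Hdgᵏ⁺¹(X, ℤ)` (the tree's `lefschetzPow_mem_integralHodgeClassesIn`) with `⟨θ^{∧l}, θ ∧ z⟩_e = ⟨θ^{∧(l+1)}, z⟩_e` (§1); only «`δ_k` is a degree» and «`δ_{k+1}` divides all
degrees» are used. [cite: Lange2023AbelianVarietiesComplex, §6.2.4 (PDF p. 310); §7.3.2 (1); §5.4.1 (5.22) (PDF p. 275)] [cite: VoisinHodgeI2002, §6.2.3 Lemma 6.26; §7.1.2 (PDF p. 134)] -/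
theorem thetaDegree_generator_succ_dvd (hη : IsRiemannForm Φ η) (e : Fin n ≃ ι) (hn : 2 * (l + 1) + 2 * k = n) (hn₁ : 2 * l + 2 * (k + 1) = n)
    {δ δ₁ : ℕ} (hδ : ∃ z ∈ integralHodgeClassesIn Φ (2 * k) k, poincarePairing Φ e hn (wedgePow (ofRealForm η) (l + 1)) z = (δ : ℂ))
    (hδ₁ : ∀ z ∈ integralHodgeClassesIn Φ (2 * (k + 1)) (k + 1), ∃ c : ℤ, poincarePairing Φ e hn₁ (wedgePow (ofRealForm η) l) z = c ∧ (δ₁ : ℤ) ∣ c) :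
    δ₁ ∣ δ := by
  obtain ⟨z, hz, hzδ⟩ := hδ
  have h1 : 2 * 1 + 2 * k = 2 * (k + 1) := by ring
  have hLH : lefschetzPow η 1 h1 z ∈ integralHodgeClassesIn Φ (2 * (k + 1)) (k + 1) := lefschetzPow_mem_integralHodgeClassesIn hη h1 (Nat.add_comm 1 k) hz
  obtain ⟨c, hc, hdvd⟩ := hδ₁ _ hLH
  rw [poincarePairing_wedgePow_lefschetzPow_one Φ η e h1 hn₁ hn] at hc
  have hcδ : c = δ := by exact_mod_cast hc.symm.trans hzδ
  rw [hcδ] at hdvd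
  exact Int.natCast_dvd_natCast.1 hdvd

end Chain

/-! ## §4 The lower half: `δ_p = ((g−p)!·d₁⋯d_{g−p})·n_p` -/

section LowerHalf

variable {ι : Type*} [Fintype ι] [DecidableEq ι] {E : Type*} [NormedAddCommGroup E] [NormedSpace ℂ E]
  {Φ : (ι → ℝ) ≃L[ℝ] E} {j n p q : ℕ} {η : E [⋀^Fin 2]→L[ℝ] ℝ} {d : Fin (j + 2) → ℕ}

/-- **`δ_p = ((g−p)!·d₁⋯d_{g−p})·n_p` for `2p ≤ g`** (`2p + q = g`, `B = ⟨·, γ_q ∧ ·⟩_e` on `H^{2p}(X, ℤ)`, `n_p = [B(γ_p, H^{2p}(X, ℤ)) : B(γ_p, Hdgᵖ(X, ℤ))]`): g49-#7's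
`{⟨θ^{∧(g−p)}, y⟩ : y ∈ Hdgᵖ(X, ℤ)} = ((g−p)!·d₁⋯d_{g−p})·n_p·ℤ` and the uniqueness of the positive generator.
[cite: Lange2023AbelianVarietiesComplex, §2.5.3 Thm. 2.5.16, Cor. 2.5.17 (d) (PDF p. 135); §6.2.4 (PDF p. 310 L9–L13); §5.4.1 (5.22)–(5.23) (PDF p. 275)] [cite: BenoistDebarre2023SmoothSubvarietiesJacobians, §1 (p. 3); §3 proof of Thm. 3.7 (p. 7)] -/
theorem IsPolarizationType.thetaDegree_generator_eq_content_mul_relIndex (hd : IsPolarizationType Φ η d) (hη : IsRiemannForm Φ η)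
    (hp : p ≤ j + 2) (hq : q ≤ j + 2) (hpq : p + q ≤ j + 2)
    {γq : E [⋀^Fin (2 * q)]→L[ℝ] ℂ} (hγq : wedgePow (ofRealForm η) q = ((q.factorial * ∏ i : Fin q, d (Fin.castLE hq i) : ℕ) : ℂ) • γq)
    {γpq : E [⋀^Fin (2 * (p + q))]→L[ℝ] ℂ}
    (hγpq : wedgePow (ofRealForm η) (p + q) = (((p + q).factorial * ∏ i : Fin (p + q), d (Fin.castLE hpq i) : ℕ) : ℂ) • γpq)
    (e : Fin n ≃ ι) (hn : 2 * p + (2 * q + 2 * p) = n) (hn' : 2 * (p + q) + 2 * p = n) {B : BilinForm ℤ ↥(integralForms Φ (2 * p))}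
    (hB : ∀ x y : ↥(integralForms Φ (2 * p)),
      ((B x y : ℤ) : ℂ) = poincarePairing Φ e hn (x : E [⋀^Fin (2 * p)]→L[ℝ] ℂ) (γq.wedge (y : E [⋀^Fin (2 * p)]→L[ℝ] ℂ)))
    (γM : ↥(AddSubgroup.toIntSubmodule ((integralHodgeClassesIn Φ (2 * p) p).addSubgroupOf (integralForms Φ (2 * p)))))
    (hγM : wedgePow (ofRealForm η) p = ((p.factorial * ∏ i : Fin p, d (Fin.castLE hp i) : ℕ) : ℂ) •
      (((γM : ↥(AddSubgroup.toIntSubmodule ((integralHodgeClassesIn Φ (2 * p) p).addSubgroupOf (integralForms Φ (2 * p))))) : ↥(integralForms Φ (2 * p))) : E [⋀^Fin (2 * p)]→L[ℝ] ℂ))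
    {δ : ℕ}
    (hδ : (∀ z ∈ integralHodgeClassesIn Φ (2 * p) p, ∃ c : ℤ, poincarePairing Φ e hn' (wedgePow (ofRealForm η) (p + q)) z = c ∧ (δ : ℤ) ∣ c) ∧
      ∃ z ∈ integralHodgeClassesIn Φ (2 * p) p, poincarePairing Φ e hn' (wedgePow (ofRealForm η) (p + q)) z = (δ : ℂ)) :
    δ = ((p + q).factorial * ∏ i : Fin (p + q), d (Fin.castLE hpq i)) *
      (LinearMap.range (B.restrict (AddSubgroup.toIntSubmodule ((integralHodgeClassesIn Φ (2 * p) p).addSubgroupOf (integralForms Φ (2 * p)))) γM)).toAddSubgroup.relIndex (LinearMap.range (B (γM : ↥(integralForms Φ (2 * p))))).toAddSubgroup := by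
  have h7 := hd.poincarePairing_wedgePow_hodgeLattice_eq_content_mul hη hp hq hpq hγq hγpq e hn hn' hB γM hγM
  -- `δ ∣ C·n`: the degree `C·n` is attained on the Hodge lattice
  obtain ⟨y, hy⟩ := h7.2
  obtain ⟨c, hc, hδc⟩ := hδ.1 _ (AddSubgroup.mem_addSubgroupOf.1 y.2)
  have hcZ : c = ((((p + q).factorial * ∏ i : Fin (p + q), d (Fin.castLE hpq i)) : ℕ) : ℤ) *
      ((((LinearMap.range (B.restrict (AddSubgroup.toIntSubmodule ((integralHodgeClassesIn Φ (2 * p) p).addSubgroupOf (integralForms Φ (2 * p)))) γM)).toAddSubgroup.relIndex (LinearMap.range (B (γM : ↥(integralForms Φ (2 * p))))).toAddSubgroup : ℕ)) : ℤ) := by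
    exact_mod_cast hc.symm.trans hy
  rw [hcZ] at hδc
  have h1 : δ ∣ ((p + q).factorial * ∏ i : Fin (p + q), d (Fin.castLE hpq i)) *
      (LinearMap.range (B.restrict (AddSubgroup.toIntSubmodule ((integralHodgeClassesIn Φ (2 * p) p).addSubgroupOf (integralForms Φ (2 * p)))) γM)).toAddSubgroup.relIndex (LinearMap.range (B (γM : ↥(integralForms Φ (2 * p))))).toAddSubgroup := by
    exact_mod_cast hδc
  -- `C·n ∣ δ`: `δ` is a degree on the Hodge lattice, `= C·c₁` with `n ∣ c₁`
  obtain ⟨z, hz, hzδ⟩ := hδ.2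
  obtain ⟨c₁, hc₁, hnc₁⟩ := h7.1 ⟨⟨z, integralHodgeClassesIn_le_integralForms Φ (2 * p) p hz⟩, AddSubgroup.mem_addSubgroupOf.2 hz⟩
  have hδZ : (δ : ℤ) = ((((p + q).factorial * ∏ i : Fin (p + q), d (Fin.castLE hpq i)) : ℕ) : ℤ) * c₁ := by
    exact_mod_cast hzδ.symm.trans hc₁
  have h2' : ((((p + q).factorial * ∏ i : Fin (p + q), d (Fin.castLE hpq i)) : ℕ) : ℤ) *
      ((((LinearMap.range (B.restrict (AddSubgroup.toIntSubmodule ((integralHodgeClassesIn Φ (2 * p) p).addSubgroupOf (integralForms Φ (2 * p)))) γM)).toAddSubgroup.relIndex (LinearMap.range (B (γM : ↥(integralForms Φ (2 * p))))).toAddSubgroup : ℕ)) : ℤ) ∣ (δ : ℤ) := by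
    rw [hδZ]
    exact mul_dvd_mul_left _ hnc₁
  have h2 : ((p + q).factorial * ∏ i : Fin (p + q), d (Fin.castLE hpq i)) *
      (LinearMap.range (B.restrict (AddSubgroup.toIntSubmodule ((integralHodgeClassesIn Φ (2 * p) p).addSubgroupOf (integralForms Φ (2 * p)))) γM)).toAddSubgroup.relIndex (LinearMap.range (B (γM : ↥(integralForms Φ (2 * p))))).toAddSubgroup ∣ δ := by
    exact_mod_cast h2'
  exact Nat.dvd_antisymm h1 h2

end LowerHalf

/-! ## §5 The general polarised abelian variety: `δ_k·(k!·d₁⋯d_k) = g!·d₁⋯d_g` in EVERY codimension -/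

section General

variable {ι : Type*} [Fintype ι] [DecidableEq ι] {E : Type*} [NormedAddCommGroup E] [NormedSpace ℂ E]
  {Φ : (ι → ℝ) ≃L[ℝ] E} {j n k l : ℕ} {η : E [⋀^Fin 2]→L[ℝ] ℝ} {d : Fin (j + 2) → ℕ}

/-- **`dim_ℚ Bᵏ(X) = 1 ⟹ δ_k·(k!·d₁⋯d_k) = g!·d₁⋯d_g`** (`k + l = g`): when `Hdgᵏ(X, ℤ) = ℤγ_k` (Mattuck-general, g36-#1 §7), every `θ`-degree of a codimension-`k`
integral Hodge class is a multiple of `deg_θ(γ_k) = ⟨θ^{∧l}, θ^{∧k}⟩_e/(k!·d₁⋯d_k) = ±g!·d₁⋯d_g/(k!·d₁⋯d_k)`, so the least positive one is `|deg_θ(γ_k)|`. This covers the UPPER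
half `k > g/2` as well (no Lefschetz form): e.g. on a very general principally polarised `X` every integral Hodge curve class has `θ`-degree divisible by
`δ_{g−1} = g!/(g−1)! = g`, the degree of the minimal curve class `θ^{g−1}/(g−1)!`.
[cite: Lange2023AbelianVarietiesComplex, §7.3.1 Thm. 7.3.1, Prop. 7.3.3 (PDF pp. 336–337); §2.5.3 Thm. 2.5.16, Cor. 2.5.17 (d) (PDF p. 135); §6.2.4 (PDF p. 310)]
[cite: BenoistDebarre2023SmoothSubvarietiesJacobians, §1 (p. 3); §3 Prop. 3.3 and proof of Thm. 3.7 (p. 7)] -/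
theorem IsPolarizationType.thetaDegree_generator_mul_content_eq_of_finrank_hodgeClasses_eq_one (hd : IsPolarizationType Φ η d) (hη : IsRiemannForm Φ η)
    (hk : k ≤ j + 2) (hkl : k + l = j + 2) (e : Fin n ≃ ι) (hn : 2 * l + 2 * k = n) (hB1 : finrank ℚ ↥(hodgeClasses Φ k) = 1) {δ : ℕ}
    (hδ : (∀ z ∈ integralHodgeClassesIn Φ (2 * k) k, ∃ c : ℤ, poincarePairing Φ e hn (wedgePow (ofRealForm η) l) z = c ∧ (δ : ℤ) ∣ c) ∧
      ∃ z ∈ integralHodgeClassesIn Φ (2 * k) k, poincarePairing Φ e hn (wedgePow (ofRealForm η) l) z = (δ : ℂ)) :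
    δ * (k.factorial * ∏ i : Fin k, d (Fin.castLE hk i)) = (j + 2).factorial * ∏ i, d i := by
  -- the minimal class `γ_k`, its degree `c₀`, and `(k!·d₁⋯d_k)·|c₀| = g!·d₁⋯d_g`
  obtain ⟨γ, hγZ, hγ⟩ := hd.exists_mem_integralForms_wedgePow_eq_content_smul hk
  have hγH := mem_integralHodgeClassesIn_of_wedgePow_eq_content_smul hd hη hk hγZ hγ
  obtain ⟨c₀, hc₀, hδc₀⟩ := hδ.1 γ hγH
  have hval := hd.orientationSign_mul_poincarePairing_wedgePow_wedgePow Φ hη (show l + k = j + 2 by omega) e hn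
  rw [hγ, map_smul, smul_eq_mul, hc₀] at hval
  have hvalZ : orientationSign Φ e * (((k.factorial * ∏ i : Fin k, d (Fin.castLE hk i)) : ℕ) : ℤ) * c₀ =
      (-1) ^ (j + 2) * ((((j + 2).factorial * ∏ i, d i) : ℕ) : ℤ) := by
    apply Int.cast_injective (α := ℂ)
    push_cast at hval ⊢
    linear_combination hval
  have habs : (k.factorial * ∏ i : Fin k, d (Fin.castLE hk i)) * c₀.natAbs = (j + 2).factorial * ∏ i, d i := by
    have h := congrArg Int.natAbs hvalZ
    have hs : (orientationSign Φ e).natAbs = 1 := by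
      have h1 := congrArg Int.natAbs (orientationSign_mul_self Φ e)
      rw [Int.natAbs_mul, Int.natAbs_one] at h1
      exact Nat.eq_one_of_mul_eq_one_left h1
    simp only [Int.natAbs_mul, Int.natAbs_pow, Int.natAbs_neg, Int.natAbs_one, one_pow, one_mul, Int.natAbs_natCast, hs] at h
    exact h
  -- `Hdgᵏ(X, ℤ) = ℤγ_k`, so every degree is a multiple of `c₀`; in particular `c₀ ∣ δ`
  have hzm := hd.integralHodgeClasses_eq_zmultiples_of_finrank_eq_one hη hk hγZ hγ hB1
  obtain ⟨z, hz, hzδ⟩ := hδ.2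
  have hz' : z ∈ integralHodgeClasses Φ k := hz
  rw [hzm, AddSubgroup.mem_zmultiples_iff] at hz'
  obtain ⟨a, rfl⟩ := hz'
  rw [map_zsmul, hc₀, zsmul_eq_mul] at hzδ
  have hδZ : (δ : ℤ) = a * c₀ := by exact_mod_cast hzδ.symm
  have h1 : δ ∣ c₀.natAbs := Int.natCast_dvd.1 hδc₀
  have h2 : c₀.natAbs ∣ δ := Int.dvd_natCast.1 ⟨a, by rw [hδZ, mul_comm]⟩
  rw [Nat.dvd_antisymm h1 h2, mul_comm]
  exact habs

/-- **`Sp(Λ_ℝ, E) ⊆ Hg(X) ⟹ δ_k·(k!·d₁⋯d_k) = g!·d₁⋯d_g` for every `k ≤ g`** (the general member of the moduli space, Lange Prop. 7.3.3 ⟹ Thm. 7.3.1): the `θ`-degrees of the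
integral Hodge classes of ANY codimension on a general polarised abelian variety are exactly the multiples of the degree of the minimal class. Principal, `k = g − 1`:
every integral Hodge curve class on a very general p.p.a.v. has `θ`-degree divisible by `g`.
[cite: Lange2023AbelianVarietiesComplex, §7.3.1 Thm. 7.3.1, Prop. 7.3.2, Prop. 7.3.3 (PDF pp. 336–337); §2.5.3 Cor. 2.5.17 (d) (PDF p. 135); §6.2.4 (PDF p. 310)] [cite: BenoistDebarre2023SmoothSubvarietiesJacobians, §1 (p. 3); §3 Prop. 3.3] -/
theorem IsPolarizationType.thetaDegree_generator_mul_content_eq_of_spGroup_le [FiniteDimensional ℂ E] (hd : IsPolarizationType Φ η d) (hη : IsRiemannForm Φ η)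
    (hHg : spGroup Φ η ≤ hodgeGroup Φ) (hk : k ≤ j + 2) (hkl : k + l = j + 2) (e : Fin n ≃ ι) (hn : 2 * l + 2 * k = n) {δ : ℕ}
    (hδ : (∀ z ∈ integralHodgeClassesIn Φ (2 * k) k, ∃ c : ℤ, poincarePairing Φ e hn (wedgePow (ofRealForm η) l) z = c ∧ (δ : ℤ) ∣ c) ∧
      ∃ z ∈ integralHodgeClassesIn Φ (2 * k) k, poincarePairing Φ e hn (wedgePow (ofRealForm η) l) z = (δ : ℂ)) :
    δ * (k.factorial * ∏ i : Fin k, d (Fin.castLE hk i)) = (j + 2).factorial * ∏ i, d i := by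
  have hfin : finrank ℂ E = j + 2 := by
    have hcard : Fintype.card ι = 2 * (j + 2) := hd.card_eq
    let e' : Fin (2 * (j + 2)) ≃ ι := (Fintype.equivFinOfCardEq hcard).symm
    have h1 := finrank_real_of_complex E
    have h2 := finrank_real_eq Φ e'
    omega
  exact hd.thetaDegree_generator_mul_content_eq_of_finrank_hodgeClasses_eq_one hη hk hkl e hn
    (hη.finrank_hodgeClasses_eq_one_of_spGroup_le hHg (by rw [hfin]; exact hk)) hδ

end General

end Literature.Geometry.Kaehler.ComplexTorus

end
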